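/- Copyright: the b2b-balaban cell (near-miss cell 7), T⁴-continuum fan-out, row-NE7b OWNER lineage `t4-ne7b-p1` (gen 101) —
(α)-instance, THE END AT THE TOWER, part 1: the record.  Released under the licence of the surrounding project. -/
import Summits.QuantumFields.BalabanUV.T4Continuum.Support.HistoryRealiseCellsRunAssemblyWTVSDataLWL
import Summits.QuantumFields.BalabanUV.T4Continuum.Support.B16HistoryStepDisplayPinned

/-!
# (α)-INSTANCE — THE END RECORD AT THE TOWER, part 1: `TowerReadDataLWL` = the lattice-unit prefix record `HistReadDataLWL` WITH
RUN A IN TOWER FORM (IR-97-2 `Tower` ∕ `skelFam` ∕ `reprFam`, IR-99-3 `StepReading`, IR-100-1 (A) `HwPinned`)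

Summits-side support leaf of the T⁴-continuum cell (rung (B)+1 on a FINITE torus only; NOT infinite volume, NOT the mass gap, NOT
Clay; NOT a proof of NE7b — the cell's OWN estimate `T4WeightBudget.RelWeightBound`, NOT PRINTED, NOT PROVED).  [folklore] ONE
`structure` (a hypothesis SHAPE: data + located displays + C-side letters, NOTHING of Bałaban's asserted); no `[cite:]` tag, no `Prop`
fact minted, zero `sorry`.  `HistReadDataLWL` (p303444) and its road `…LWLP82` (p303949) are CONSUMED by part 2, unchanged.

WHY.  `HistReadDataLWL` displays run A through FOUR abstract objects — the operations `RA`, the reading `ℛ`, the bundle `Φf` and THE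
identification `hR : HistRead ℛ Φf RA l₀ K₀` (R2 of `WALL-NE7b-P1.md` §2) — plus the binders `holdsA` ((1.72) holds), `hN`,
`hRm`∕`hRmS`∕`hRm2`, `hF` (`FactorRead`), `hΛL` (the volume letter).  For a run IN TOWER FORM (a K-step tower of one-step positive
operations, a step reading `𝒮` of its choices, the pinned per-step display `HwPinned T 𝒮 sB sR cΛ M gs K₀`) ALL of these are theorems of
the J-chain (`reprFam`, `𝒮.reading`, `factorsPinned`, `holdsFam`, `histRead_of_hwPinned`, `newOK_run`, flow rows, `factorRead_factorsPinned`,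
`log_Λ_factorsPinned`).  THIS FILE types the record carrying the tower data INSTEAD of those slots; part 2 (`B16HistoryTowerEndLWLP82`)
builds `HistReadDataLWL` from it and composes the headline.  WHAT: `HistReadDataLWL` FIELD FOR FIELD with this delta — PARAMETERS: choice
type `P` (`[DecidableEq P]`), level classes `X K j` with good classes `𝒢 K j` (the END's are the LAST level `X K K`, `𝒢 K K`), measures
`μ K` on `X K K`, run B's `I' Y νB 𝒢'` as in LWL; REPLACED `RA ρA holdsA` ↦ `T p₀ hp₀ ρ₀ hρ₀ h0 B hB` + the sup display `hBρ` (`intA`,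
`H2A` kept at `reprFam`∕`densFam`); `ℛ hN hRm hRmS hRm2` ↦ `𝒮 hν0 hν` + memory rows AT FLOW LEVEL (`hL hs isRj one_le_R hprof hdrop h29` at
`𝒮`; `hD hreg` per term at `𝒮.reading T p₀`); `Φf hR hF hΛL` ↦ the letter `sB` + `hw : HwPinned …` at the PINNED renewal letter `sRpin`
(LWL's `hF` right member) and the runs' couplings `gsOf`; `hBA` as `log (B K t) ≤ BAi`; ADDED `hℓ` (`0 ≤ ℓ_j` on every performed range —
inside `ForSmallCouplings` a consequence of `Tuned`; displayed so the pinned bundle's `one_le_Λ` is available to the field types); KEPT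
VERBATIM: everything else.  HONEST SCOPE: a bundling of HYPOTHESES over an ABSTRACT tower; `hw` is R-class until (A1c) supplies
Bałaban's tower and J4 (IR-100-3) reads it off `B16StepFactorsPrinted`; nothing discharged here; ρ UNVALUED; NEEDS-CONSTANT 0.  NE7b NOT
proved; spine 0∕9.  HONEST DEPENDENCY (cell): continuum YM on T⁴ ⇐ BetaPertH ∧ nine spine estimates (0/9 proved); BetaPertH ⇐ (D1) ∧
(D4) ∧ CAP+tail; G-an2-4 gates asym, D1 and NE2/3/4.  This file changes none of it.
-/

open Finset MeasureTheory
open Literature.MathematicalPhysics.QuantumFieldTheory.Balaban1983to89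
open T4PersistenceDictionary T4PersistentHistoryCount T4BankedInduction T4PrintedShapeBanking
open T4WeightBudget T4GlobalDenominator T4LiveClassFibration T4LiveStructureGas T4LiveGasToTerms T4RecordPriceSeam
open T4PartnerMultiplicity T4IndicatorShell T4MatchingAssembly T4MatchingClosure T4MatchingClosureSocket T4Continuum
open T4StabilitySocket T4BranchingRecordsGas T4TaggedShapeBanking T4CanonicalMenus T4RenewalChains
open Summit.QuantumFields.BalabanUV.T4Continuum.PlacementBatch Summit.QuantumFields.BalabanUV.T4Continuum.PlacementSkeleton
open Summit.QuantumFields.BalabanUV.T4Continuum.CountThresholdUniform Summit.QuantumFields.BalabanUV.T4Continuum.CountThresholdExit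
open Summit.QuantumFields.BalabanUV.T4Continuum.CountSeamJunction Summit.QuantumFields.BalabanUV.T4Continuum.LateMergers
open Summit.QuantumFields.BalabanUV.T4Continuum.HistoryFlow Summit.QuantumFields.BalabanUV.T4Continuum.HistoryRegeneration
open Summit.QuantumFields.BalabanUV.T4Continuum.HistoryTables Summit.QuantumFields.BalabanUV.T4Continuum.HistoryAssemblyTrees
open Summit.QuantumFields.BalabanUV.T4Continuum.HistoryAssemblyTerms Summit.QuantumFields.BalabanUV.T4Continuum.HistoryAssemblyPedigree
open Summit.QuantumFields.BalabanUV.T4Continuum.HistoryConstants Summit.QuantumFields.BalabanUV.T4Continuum.HistoryGen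
open Literature.MathematicalPhysics.QuantumFieldTheory.Balaban1983to89.B13ScaleTransfer
open Summit.QuantumFields.BalabanUV.T4Continuum.ZoneSkeleton Summit.QuantumFields.BalabanUV.T4Continuum.HistorySocketTH
open Summit.QuantumFields.BalabanUV.T4Continuum.HistoryCaps Summit.QuantumFields.BalabanUV.T4Continuum.HistoryAssemblyPrice
open Summit.QuantumFields.BalabanUV.T4Continuum.HistoryBankingLE Summit.QuantumFields.BalabanUV.T4Continuum.HistoryExitLE
open Summit.QuantumFields.BalabanUV.T4Continuum.HistoryAssemblyTreesLE Summit.QuantumFields.BalabanUV.T4Continuum.HistoryAssemblyTermsLE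
open Summit.QuantumFields.BalabanUV.T4Continuum.HistoryRealise Summit.QuantumFields.BalabanUV.T4Continuum.HistoryAssemblyRealiseLE
open Summit.QuantumFields.BalabanUV.T4Continuum.HistoryAssemblyMult Summit.QuantumFields.BalabanUV.T4Continuum.HistoryAssemblyMultKey
open Summit.QuantumFields.BalabanUV.T4Continuum.HistoryAssemblyRealiseRun Summit.QuantumFields.BalabanUV.T4Continuum.HistoryAssemblyRealiseMult
open Summit.QuantumFields.BalabanUV.T4Continuum.HistoryZones Summit.QuantumFields.BalabanUV.T4Continuum.HistoryRealiseCells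
open Summit.QuantumFields.BalabanUV.T4Continuum.HistoryRealiseCellsRun Summit.QuantumFields.BalabanUV.T4Continuum.HistoryAssemblyRealiseRunMult
open Summit.QuantumFields.BalabanUV.T4Continuum.HistoryRealiseCellsRunMult Summit.QuantumFields.BalabanUV.T4Continuum.HistoryAssemblyMultInstance
open Summit.QuantumFields.BalabanUV.T4Continuum.HistoryJoinsPlacedMember Summit.QuantumFields.BalabanUV.T4Continuum.PlacementSkeleton
open Summit.QuantumFields.BalabanUV.T4Continuum.HistoryJoinsPlacedMult Summit.QuantumFields.BalabanUV.T4Continuum.HistoryRealiseDistinct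
open Summit.QuantumFields.BalabanUV.T4Continuum.HistoryRegionTemplates Summit.QuantumFields.BalabanUV.T4Continuum.HistoryCaps
open Summit.QuantumFields.BalabanUV.T4Continuum.HistoryZoneEvolve (cth)
open Literature.MathematicalPhysics.QuantumFieldTheory.Balaban1983to89.B16SProfile (DropCtl)
open Summit.QuantumFields.BalabanUV.T4Continuum.HistoryRealiseCellsRunMultEnd Summit.QuantumFields.BalabanUV.T4Continuum.HistoryRealiseCellsRunMultEndD
open Summit.QuantumFields.BalabanUV.T4Continuum.HistoryRealiseCellsRunPinnedT3b Summit.QuantumFields.BalabanUV.T4Continuum.HistoryHybridRescale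
open Summit.QuantumFields.BalabanUV.T4Continuum.HistoryRealiseCellsRunApex (exists_const_schemeZ)
open Summit.QuantumFields.BalabanUV.T4Continuum.HistoryRealisePrint Summit.QuantumFields.BalabanUV.T4Continuum.HistoryRealiseWeak
open Summit.QuantumFields.BalabanUV.T4Continuum.HistoryRealisePrintReading Summit.QuantumFields.BalabanUV.T4Continuum.HistoryRealiseWeakReading
open Summit.QuantumFields.BalabanUV.T4Continuum.HistoryRealisePrintCells Summit.QuantumFields.BalabanUV.T4Continuum.HistoryRealiseWeakCells
open Summit.QuantumFields.BalabanUV.T4Continuum.HistoryRealiseCellsRunApexT3b Summit.QuantumFields.BalabanUV.T4Continuum.HistoryRealiseCellsRunApexT3bW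
open Summit.QuantumFields.BalabanUV.T4Continuum.HistoryRealiseCellsRunApexT3bWT Summit.QuantumFields.BalabanUV.T4Continuum.HistoryRealiseCellsRunPinnedT3bWT
open Summit.QuantumFields.BalabanUV.T4Continuum.HistoryRealiseCellsRunHeadlineT3bWT
open Summit.QuantumFields.BalabanUV.T4Continuum.HistoryRealiseCellsRunApexT3bWTV Summit.QuantumFields.BalabanUV.T4Continuum.HistoryBankingVolumePlug
open Summit.QuantumFields.BalabanUV.T4Continuum.HistoryRealiseCellsRunApexT3bWTVS
open Summit.QuantumFields.BalabanUV.T4Continuum.HistoryGenealogyRealise Summit.QuantumFields.BalabanUV.T4Continuum.HistoryGenealogyInstantiate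
open Summit.QuantumFields.BalabanUV.T4Continuum.B16HistoryIndexedRepr Summit.QuantumFields.BalabanUV.T4Continuum.B16HistoryIndexedTrunc
open Summit.QuantumFields.BalabanUV.T4Continuum.HistoryBankingDiscountCharge Summit.QuantumFields.BalabanUV.T4Continuum.HistoryBankingCreditRead
open Summit.QuantumFields.BalabanUV.T4Continuum.HistoryBankingFibreRoom Summit.QuantumFields.BalabanUV.T4Continuum.HistoryPriceKeys
open Summit.QuantumFields.BalabanUV.T4Continuum.HistoryRealiseCellsRunSupplyWTVS Summit.QuantumFields.BalabanUV.T4Continuum.HistoryRealiseCellsRunSupplyKeysWTVS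
open Summit.QuantumFields.BalabanUV.T4Continuum.HistoryRealiseCellsRunAssemblyWTVSData Summit.QuantumFields.BalabanUV.T4Continuum.HistoryRealiseCellsRunAssemblyWTVSDataL
open Summit.QuantumFields.BalabanUV.T4Continuum.HistoryBankingSharpShares (sBsharp ell)
open Summit.QuantumFields.BalabanUV.T4Continuum.HistoryBankingRoundingUnrounded (sRunr ApFlat)
open Summit.QuantumFields.BalabanUV.T4Continuum.HistoryBankingVolumeWindowLattice (uvolL)
open Literature.MathematicalPhysics.QuantumFieldTheory.Balaban1983to89.TreeLength Literature.MathematicalPhysics.QuantumFieldTheory.Balaban1983to89.B16MergeGeometry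
open Summit.QuantumFields.BalabanUV.T4Continuum.HistoryAdmissible Summit.QuantumFields.BalabanUV.T4Continuum.HistoryGenealogyExtraction
open Summit.QuantumFields.BalabanUV.T4Continuum.HistoryGenealogyPedigree Summit.QuantumFields.BalabanUV.T4Continuum.HistoryTouchComponents
open Summit.QuantumFields.BalabanUV.T4Continuum.B16HistoryReprChain Summit.QuantumFields.BalabanUV.T4Continuum.B16HistoryReprInstance
open Summit.QuantumFields.BalabanUV.T4Continuum.B16HistoryReprRead Summit.QuantumFields.BalabanUV.T4Continuum.B16HistoryReprReadCausal
open Summit.QuantumFields.BalabanUV.T4Continuum.B16HistoryStepDisplayPinned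

namespace Summit.QuantumFields.BalabanUV.T4Continuum.B16HistoryTowerEndDataLWL

noncomputable section

set_option synthInstance.maxSize 1024

/-! ## §1 The pinned letters read off the prefix (abbreviations) -/

section Letters

variable {F : T4Family} {G : Type*} [GaugeGroup G] [MeasurableSpace G] [HaarData G]

/-- **THE RUNS' COUPLING SEQUENCES** under the prefix: run `K` tuned at `g₀ K` has couplings `(D.C ⟨K, F.m, g₀ K⟩).flow.g`.
An abbreviation. [folklore] -/
@[reducible] def gsOf (D : FiniteEpsData F G) (g₀ : ℕ → ℝ) : ℕ → ℕ → ℝ := fun K => (D.C ⟨K, F.m, g₀ K⟩).flow.g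

/-- **THE PINNED RENEWAL LETTER** of run `K`: LWL's `hF` right member, the unrounded letter `S_h = sRunr γ₀ A₁ M Lr β₀ d p₁ (R K) g^K h`
(R-OWNER-47-1 (a)) at the reading's sizes `R K`.  An abbreviation. [folklore] -/
@[reducible] def sRpin (D : FiniteEpsData F G) (O : PrintedO1s) (Lr : ℝ) (p₁ : ℕ) (g₀ : ℕ → ℝ) (R : ℕ → ℕ → ℕ) :
    ℕ → ℕ → ℝ :=
  fun K => sRunr O.γ₀ O.A₁ O.M Lr O.β₀ O.d p₁ (R K) (D.C ⟨K, F.m, g₀ K⟩).flow.g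

end Letters

/-! ## §2 The record -/

section Data

variable {F : T4Family} {G : Type*} [GaugeGroup G] [MeasurableSpace G] [HaarData G] [RegularGaugeGroup G]

/-- **THE INPUTS OF THE (α) ASSEMBLY UNDER THE HEADLINE's OWN PREFIX WITH RUN A IN TOWER FORM** (HYPOTHESIS SHAPE — data + located
displays + C-side letters, NOTHING of Bałaban's asserted): `HistReadDataLWL` with `RA ρA holdsA ℛ Φf hR hN hRm hRmS hRm2 hF hΛL` replaced
by a tower `T` with small-field choices `p₀`, dressed initial densities `ρ₀` bounded by `B` on the window (`hBρ`), a step reading `𝒮`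
(`hν0`, `hν`, flow-level memory rows), the sharp birth letter `sB`, the PINNED PER-STEP DISPLAY `hw : HwPinned …` at the pinned renewal
letter `sRpin` and the runs' couplings `gsOf`, and the sign row `hℓ`; every other field is LWL's, verbatim up to the substitution
`I ↦ skelFam T p₀`, `ℛ ↦ 𝒮.reading T p₀`, `RA ↦ reprFam …`, `Φf ↦ factorsPinned …`. [folklore] -/
structure TowerReadDataLWL (D : FiniteEpsData F G) (C : T4PrintedShapeBanking.Consts) (O : PrintedO1s) (θv : ℝ)
    (rr d n : ℕ) (hn : 0 < n) (g₀ : ℕ → ℝ) (os : List (ULoop F))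
    (cΛ M Lr Φ β₀ : ℝ) (p₁ η η' κ κ₂ κᵥ : ℕ)
    (P : Type) [DecidableEq P] (X : ℕ → ℕ → Type) (𝒢 : (K j : ℕ) → GoodClass (X K j))
    [∀ K, MeasurableSpace (X K K)] (μ : (K : ℕ) → Measure (X K K)) [∀ K, IsFiniteMeasure (μ K)]
    {DomK' : ℕ → Type} (I' : (K : ℕ) → HIndex (DomK' K))
    (Y : ℕ → Type) [∀ K, MeasurableSpace (Y K)] (νB : (K : ℕ) → Measure (Y K))
    [∀ K, IsFiniteMeasure (νB K)] (𝒢' : (K : ℕ) → GoodClass (Y K)) where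
  /-- the source radius -/
  l₀ : ℝ
  /-- the volume factor of the matching remainders -/
  vol : ℝ
  /-- the source radius is positive -/
  l₀_pos : 0 < l₀
  /-- the volume factor is positive -/
  vol_pos : 0 < vol
  /-- the threshold in the number of steps -/
  K₀ : ℕ
  /-- THE TOWER of run A: per cutoff `K`, `K` one-step positive operations branching over the choices (IR-97-2) -/
  T : (K : ℕ) → Tower P (X K) (𝒢 K)
  /-- the small-field choice at every step of every run -/
  p₀ : ℕ → ℕ → P
  /-- the small-field choice lies on every branch -/
  hp₀ : ∀ K j g, p₀ K j ∈ (T K).branch j g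
  /-- the dressed initial densities `ρ₀ K t` (H2's `e^{t·obs}·ρ₀`) -/
  ρ₀ : (K : ℕ) → ℝ → X K 0 → ℝ
  /-- the dressed initial densities are good -/
  hρ₀ : ∀ K t, (𝒢 K 0).Gd (ρ₀ K t)
  /-- the dressed initial densities are non-negative -/
  h0 : ∀ K t x, 0 ≤ ρ₀ K t x
  /-- the sup letters of the dressed initial densities -/
  B : ℕ → ℝ → ℝ
  /-- the sup letters are positive -/
  hB : ∀ K t, 0 < B K t
  /-- display: the dressed initial density is bounded by its letter on the window -/
  hBρ : ∀ K t, |t| ≤ l₀ → K₀ ≤ K → ∀ y, |ρ₀ K t y| ≤ B K t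
  /-- display (integrability of the elementary terms of the tower's operations) -/
  intA : ∀ K t a, ∀ ι ∈ (skelFam T p₀ K).LIdx a, Integrable ((reprFam T p₀ ρ₀ hρ₀ h0 B hB K t).eterm a ι) (μ K)
  /-- display (H2: the dressed push-forward identity, at the tower's final density `densFam`) -/
  H2A : ∀ K t, |t| ≤ l₀ → K₀ ≤ K →
    ∫ U, Real.exp (t * T4GenFunBounds.prodObs (D.scheme g₀) K os U) * D.dens K (g₀ K) 0 U ∂fieldMeasure (F.P K) 0 G =
      ∫ x, densFam T ρ₀ K t x ∂μ K
  /-- THE STEP READING of the tower's choices (regions, cubes, classes; flow, memory — IR-99-3) -/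
  𝒮 : StepReading P d
  /-- (c1) the reading's blocking parameter is the family's -/
  hL : 𝒮.L = F.L
  /-- (c1) the reading's exponent profile is the run's own -/
  hs : 𝒮.s = runProfile F.L 𝒮.R
  /-- the small-field choice names no region -/
  hν0 : ∀ K j g, 𝒮.ν K j g (p₀ K j) = ∅
  /-- named regions are pointed, face-connected and of tree length at most their class -/
  hν : ∀ K j g p, ∀ nr ∈ 𝒮.ν K j g p, nr.1 ∈ nr.2 ∧ FaceConnected nr.2 ∧ treeLen nr.2 ≤ 𝒮.κ K nr
  /-- flow: memory domination -/
  hRm : ∀ K s k, 𝒮.Rm K s k ≤ 𝒮.R K s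
  /-- flow: memory domination, one-step form -/
  hRmS : ∀ K, K₀ ≤ K → ∀ t k, 𝒮.Rm K t (k + 1) ≤ 𝒮.R K (t + 1)
  /-- flow: non-degenerate memory -/
  hRm2 : ∀ K, K₀ ≤ K → ∀ t, 2 ≤ 𝒮.Rm K t 1
  /-- M5-3∕M5-4 letters per cutoff: sharp birth exponents -/
  sB : ℕ → ℕ → ℕ → ℝ
  /-- display: THE PINNED PER-STEP DISPLAY (IR-100-1 (A) `HwPinned`) at the pinned renewal letter and the runs' couplings -/
  hw : HwPinned T 𝒮 sB (sRpin D O Lr p₁ g₀ 𝒮.R) cΛ M (gsOf D g₀) K₀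
  /-- display (2.5): the reading's sizes are admissible for the running couplings -/
  isRj : ∀ K s, s ≤ K → B14.IsRj F.L rr ((D.C ⟨K, F.m, g₀ K⟩).flow.g s) (𝒮.R K s)
  /-- sizes are at least one -/
  one_le_R : ∀ K, K₀ ≤ K → ∀ t, 1 ≤ 𝒮.R K t
  /-- flow (K): the blocking parameter is at least four -/
  hL4 : 4 ≤ F.L
  /-- flow (K): the run's own exponent profile is non-increasing within the run -/
  hprof : ∀ K, K₀ ≤ K → ∀ t, t < K → runProfile F.L 𝒮.R K (t + 1) ≤ runProfile F.L 𝒮.R K t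
  /-- flow (K): drop control of the run's own profile -/
  hdrop : ∀ K, K₀ ≤ K → ∀ m, DropCtl (runProfile F.L 𝒮.R K) m
  /-- pass-V input condition per term: disjoint new regions -/
  hD : ∀ K, K₀ ≤ K → ∀ τ ∈ HIndex.termSet (skelFam T p₀) K, ((𝒮.reading T p₀).inputOf.run K τ).NewDisjoint
  /-- pass-V input condition per term: every new region lies in the torus' period box at its level -/
  hreg : ∀ K, K₀ ≤ K → ∀ τ ∈ HIndex.termSet (skelFam T p₀) K, ((𝒮.reading T p₀).inputOf.run K τ).RegionsInBox n K
  /-- constants: the window constant -/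
  hn₁ : 13 ≤ C.n₁
  /-- constants -/
  hE₂ : 0 < C.E₂
  /-- constants — `E₃` strictly positive -/
  hE₃pos : 0 < C.E₃
  /-- fibre shares, births -/
  φB : ℕ → ℕ → ℕ → ℝ
  /-- fibre shares, renewals -/
  φR : ℕ → ℕ → ℝ
  /-- (2.9)∕(2.7)'s letter `β′` -/
  β' : ℝ
  /-- display (2.9) on the reading's sizes -/
  h29 : ∀ K, K₀ ≤ K → B14FlowStep.FlowIneq29 (𝒮.R K) (D.C ⟨K, F.m, g₀ K⟩).flow.g F.L β' β₀ K
  /-- the term-free curly normalisation envelope -/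
  W : ℕ → ℝ
  /-- display -/
  one_le_W : ∀ K, 1 ≤ W K
  /-- the term-free envelopes' K-uniform bounds -/
  (Wi BAi mi : ℝ)
  /-- display -/
  hWi : ∀ K, W K ≤ Wi
  /-- display: the sup letters' logarithms are K-uniformly bounded on the window (the pinned bundle's `BA K t = log (B K t)`) -/
  hBA : ∀ K t, |t| ≤ l₀ → K₀ ≤ K → Real.log (B K t) ≤ BAi
  /-- display -/
  hmi : ∀ K, (μ K).real Set.univ ≤ mi
  /-- C-side: print's p. 380 volume constant is nonnegative -/
  hcΛ : 0 ≤ cΛ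
  /-- C-side: the cube-side letter `M` of the lattice volume letter is nonnegative -/
  hMΛ : 0 ≤ M
  /-- flow (ADDED): `0 ≤ ℓ_j = log (g^K_j)⁻²` on every run's performed range (couplings at most one) -/
  hℓ : ∀ K j, j ≤ K → 0 ≤ ell (gsOf D g₀ K) j
  /-- display (ρ) `FibreMass` (located, VOLUME type), at the tower's reading and pinned bundle -/
  hρ : ∀ K t, |t| ≤ l₀ → K₀ ≤ K →
    ∀ k ∈ badGMems (memA n F.L (𝒮.reading T p₀)) jhalf (HIndex.termSet (skelFam T p₀))
        (kmemA n F.L hn (lt_of_lt_of_le (by norm_num) (two_le_L F)) (𝒮.reading T p₀)) K,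
      ∑ τ ∈ fibre (kmemA n F.L hn (lt_of_lt_of_le (by norm_num) (two_le_L F)) (𝒮.reading T p₀))
          (HIndex.termSet (skelFam T p₀)) K k,
        dmassOf (𝒮.reading T p₀)
            (factorsPinned T p₀ 𝒮 B sB (sRpin D O Lr p₁ g₀ 𝒮.R) cΛ M (gsOf D g₀) hcΛ hMΛ hℓ) t τ ≤
          W K * MULTOf (sharpT (φB K) (φR K)) k
  /-- the (γ) small-field mass floor -/
  c₀ : ℝ
  /-- the site budget -/
  n₁ : ℝ
  /-- the floor is positive -/
  c₀_pos : 0 < c₀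
  /-- (γ) floor, run A -/
  floor : ∀ K, K₀ ≤ K → c₀ ≤ smallFieldMass D K (g₀ K)
  /-- (γ) floor, run B -/
  floor' : ∀ K, K₀ ≤ K → c₀ ≤ smallFieldMass D (K + 1) (g₀ (K + 1))
  /-- site budget, run A -/
  sites : ∀ K, K₀ ≤ K → ((D.C ⟨K, F.m, g₀ K⟩).numSites K : ℝ) ≤ n₁
  /-- site budget, run B -/
  sites' : ∀ K, K₀ ≤ K → ((D.C ⟨K + 1, F.m, g₀ (K + 1)⟩).numSites (K + 1) : ℝ) ≤ n₁
  /-- RUN B: run B's history-indexed operations over ITS skeleton, per cutoff and source value -/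
  RB : (K : ℕ) → ℝ → Repr172R (𝒢' K) (I' K)
  /-- RUN B: run B's dressed density after `K + 1` steps on its reference space -/
  ρB : (K : ℕ) → ℝ → Y (K + 1) → ℝ
  /-- display ((1.72) holds for run B at cutoff `K + 1`) -/
  holdsB : ∀ K t V, ρB K t V = ∑ a : (I' (K + 1)).Adm, (RB (K + 1) t).term a V
  /-- display (integrability, run B) -/
  intB : ∀ K t a, ∀ ι ∈ (I' (K + 1)).LIdx a, Integrable ((RB (K + 1) t).eterm a ι) (νB (K + 1))
  /-- display (H2, run B) -/
  H2B : ∀ K t, |t| ≤ l₀ → K₀ ≤ K →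
    ∫ U, Real.exp (t * T4GenFunBounds.prodObs (D.scheme g₀) (K + 1) os U) * D.dens (K + 1) (g₀ (K + 1)) 0 U
        ∂fieldMeasure (F.P (K + 1)) 0 G = ∫ y, ρB K t y ∂νB (K + 1)
  /-- RUN B (S, NODE O): the truncation of run B's level-`(K+1)` terms onto run A's tower index -/
  trunc : ℕ → HIndex.Idx I' → HIndex.Idx (skelFam T p₀)
  /-- display (S): the truncation maps run B's term set into run A's -/
  htr : ∀ K, K₀ ≤ K → ∀ τ' ∈ HIndex.termSet I' (K + 1), trunc K τ' ∈ HIndex.termSet (skelFam T p₀) K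
  /-- RUN B: per-term dead weights -/
  dB : ℕ → ℝ → HIndex.Idx I' → ℝ
  /-- RUN B: envelope -/
  mup : ℕ → ℝ → ℝ
  /-- RUN B: sharp ∕ share letters of run B -/
  (sB' φB' : ℕ → ℕ → ℕ → ℝ)
  /-- RUN B: share letters of run B, renewals -/
  φR' : ℕ → ℕ → ℝ
  /-- display (R «TRUNC»): run B's numerator reading per term, KEYED AT RUN A's KEYS -/
  upB : ∀ K t, |t| ≤ l₀ → K₀ ≤ K →
    ∀ k ∈ badGMems (memA n F.L (𝒮.reading T p₀)) jhalf (HIndex.termSet (skelFam T p₀))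
        (kmemA n F.L hn (lt_of_lt_of_le (by norm_num) (two_le_L F)) (𝒮.reading T p₀)) K,
      ∀ τ' ∈ HIndex.termSet I' (K + 1),
        trunc K τ' ∈ fibre (kmemA n F.L hn (lt_of_lt_of_le (by norm_num) (two_le_L F)) (𝒮.reading T p₀))
            (HIndex.termSet (skelFam T p₀)) K k →
          Repr172R.weight νB RB t τ' ≤
            dB K t τ' * LIVEOf C K (𝒮.R K) (fun m => 2 ^ (d + 3) *
                Real.log ((factorsPinned T p₀ 𝒮 B sB (sRpin D O Lr p₁ g₀ 𝒮.R) cΛ M (gsOf D g₀) hcΛ hMΛ hℓ).Λ K m))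
              (sharpT (sB' K) (sRpin D O Lr p₁ g₀ 𝒮.R K)) k * mup K t
  /-- display (R «TRUNC»): run B's dead weights are nonnegative over the composite fibres -/
  deadB_nonneg : ∀ K t, |t| ≤ l₀ → K₀ ≤ K →
    ∀ k ∈ badGMems (memA n F.L (𝒮.reading T p₀)) jhalf (HIndex.termSet (skelFam T p₀))
        (kmemA n F.L hn (lt_of_lt_of_le (by norm_num) (two_le_L F)) (𝒮.reading T p₀)) K,
      ∀ τ' ∈ HIndex.termSet I' (K + 1),
        trunc K τ' ∈ fibre (kmemA n F.L hn (lt_of_lt_of_le (by norm_num) (two_le_L F)) (𝒮.reading T p₀))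
            (HIndex.termSet (skelFam T p₀)) K k →
          0 ≤ dB K t τ'
  /-- display (ρ′) (located, VOLUME type): run B's fibre mass over the COMPOSITE fibre of a key -/
  resumB : ∀ K t, |t| ≤ l₀ → K₀ ≤ K →
    ∀ k ∈ badGMems (memA n F.L (𝒮.reading T p₀)) jhalf (HIndex.termSet (skelFam T p₀))
        (kmemA n F.L hn (lt_of_lt_of_le (by norm_num) (two_le_L F)) (𝒮.reading T p₀)) K,
      ∑ τ' ∈ (HIndex.termSet I' (K + 1)).filter (fun τ' =>
          trunc K τ' ∈ fibre (kmemA n F.L hn (lt_of_lt_of_le (by norm_num) (two_le_L F)) (𝒮.reading T p₀))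
            (HIndex.termSet (skelFam T p₀)) K k),
        dB K t τ' ≤ MULTOf (sharpT (φB' K) (φR' K)) k
  /-- display: run B's envelope bound (at `Nup := e^{BA∞}·m∞·W∞`) -/
  mup_bd : ∀ K t, |t| ≤ l₀ → K₀ ≤ K → 0 ≤ mup K t ∧ mup K t ≤ Real.exp BAi * mi * Wi
  /-- NE7c: the two runs' shell parts -/
  (shA shB : ℕ → ℝ → HIndex.Idx (skelFam T p₀) → ℝ)
  /-- NE7c's shell weight budget -/
  Wsh : ℕ → ℝ
  /-- NE7c (S): the indicator shells' relative weight bound over the tower's terms -/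
  shell : ShellWeightBound l₀ (HIndex.termSet (skelFam T p₀))
    (fun _ t => Repr172R.weight μ (reprFam T p₀ ρ₀ hρ₀ h0 B hB) t) (weightB νB RB trunc) shA shB Wsh
  /-- NE7 core budget data -/
  (Cc Rr CcRec RrRec : ℕ → ℝ → HIndex.Idx (skelFam T p₀) → ℝ)
  /-- NE7 core budget rates -/
  (ν u s₂ q₀ r s : ℕ → ℝ)
  /-- NE7 (S): the re-indexed per-term budget over the tower reading's bad classes -/
  budget : ReindexedBudget l₀ vol (HIndex.termSet (skelFam T p₀))
    (fun K t τ => Repr172R.weight μ (reprFam T p₀ ρ₀ hρ₀ h0 B hB) t τ - shA K t τ)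
    (fun K t τ => weightB νB RB trunc K t τ - shB K t τ)
    (badOfClass (bstrOf Prod.fst (memA n F.L (𝒮.reading T p₀))) (HIndex.termSet (skelFam T p₀))
      (fun K _ => badClasses Prod.fst (memA n F.L (𝒮.reading T p₀)) jhalf (HIndex.termSet (skelFam T p₀)) K))
    Cc Rr CcRec RrRec ν u s₂ q₀ r s
  /-- summable rates -/
  (sum_r : Summable r) (sum_u : Summable u) (sum_s : Summable s) (sum_s₂ : Summable s₂)
  /-- C-side signs: the volume slack is positive; `β₀, Lr, Φ ≥ 0` -/
  (hθv : 0 < θv) (hβ₀ : 0 ≤ β₀) (hLr : 0 ≤ Lr) (hΦ : 0 ≤ Φ)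
  /-- C-side: the birth-floor mass letter -/
  m : ℝ
  /-- C-side: `A₁² ≤ m` -/
  hm : O.A₁ ^ 2 ≤ m
  /-- census identity (t = d+3): `p₀ + r(d+3) + η = 2p₁` -/
  hexpR : C.p₀ + rr * (O.d + 3) + η = 2 * p₁
  /-- census identity: `r(q′+1) + r(d+3) + η′ = 2p₁` -/
  hexpR' : rr * (C.q' + 1) + rr * (O.d + 3) + η' = 2 * p₁
  /-- census identity: `r(q′+1) + κ = 2p₀` -/
  hexpB : rr * (C.q' + 1) + κ = 2 * C.p₀
  /-- census identity in LATTICE units: `1 + κ₂ = r·(q′ − d)` -/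
  hexpFL : 1 + κ₂ = rr * (C.q' - d)
  /-- census side condition in LATTICE units: `d ≤ q′` -/
  hdq : d ≤ C.q'
  /-- census identity in LATTICE units: `1 + r·d + κᵥ = 2p₀` -/
  hexpVL : 1 + rr * d + κᵥ = 2 * C.p₀
  /-- exponent gaps -/
  (hη : 1 ≤ η) (hη' : 1 ≤ η') (hκ : 1 ≤ κ) (hκ₂ : 1 ≤ κ₂) (hκᵥ : 1 ≤ κᵥ)
  /-- constants: `1 ≤ p₀` -/
  hp₀c : 1 ≤ C.p₀
  /-- C-side: the flat renewal amplitude is nonzero -/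
  hAp : ApFlat O.γ₀ O.A₁ O.M Lr O.d ≠ 0
  /-- signs of print's O(1)s -/
  (hγ₀ : 0 < O.γ₀) (hA₁ : O.A₁ ≠ 0) (hA₀ : 0 < C.A₀) (hM : 0 < O.M)
  /-- census: `β₀(d+2) ≤ 1` -/
  hβd : O.β₀ * ((O.d : ℝ) + 2) ≤ 1
  /-- φ-BUDGET, births, run A -/
  hφB : ∀ K j d', φB K j d' ≤ Φ * dshare C F.L (𝒮.R K) ((j, 0, d') : PEv)
  /-- φ-BUDGET, renewals, run A -/
  hφR : ∀ K h, φR K h ≤ Φ * dshare C F.L (𝒮.R K) ((h + 1, 1, 0) : PEv)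
  /-- φ-BUDGET, births, run B's letters -/
  hφB' : ∀ K j d', φB' K j d' ≤ Φ * dshare C F.L (𝒮.R K) ((j, 0, d') : PEv)
  /-- φ-BUDGET, renewals, run B's letters -/
  hφR' : ∀ K h, φR' K h ≤ Φ * dshare C F.L (𝒮.R K) ((h + 1, 1, 0) : PEv)
  /-- BIRTH LETTER FLOOR, run A: the sharp birth exponent is at least print's `sBsharp` -/
  hsB : ∀ K j d', sBsharp O m C (D.C ⟨K, F.m, g₀ K⟩).flow.g j d' ≤ sB K j d'
  /-- BIRTH LETTER FLOOR, run B's letters -/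
  hsB' : ∀ K j d', sBsharp O m C (D.C ⟨K, F.m, g₀ K⟩).flow.g j d' ≤ sB' K j d'
  /-- (2.7)'s power (NE7-rate row) -/
  p27 : ℕ
  /-- (2.7)'s power is at least one -/
  hp27 : 1 ≤ p27
  /-- display (2.7) per cutoff on the run's couplings -/
  h27 : ∀ K, K₀ ≤ K → B14.FlowIneq27 (D.C ⟨K, F.m, g₀ K⟩).flow.g β' β₀ p27 K

end Data

end

end Summit.QuantumFields.BalabanUV.T4Continuum.B16HistoryTowerEndDataLWL
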